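import Summits.HubbardSuperconductivity.HubbardSuperconductivity.Theorems.LevyLogBootstrapDressHalfFilledBandStates
import HarnessLib

/-!
# Route `LevyLogBootstrap`, crux `DressHalfFilled` (stmt-HubbardSuperconductivity-8148), stub 2
# `stub_plaquetteDictionary`: the product of the embedded plaquette projections is the band-state projection

Support file (torus level of the plaquette-boson dictionary; the algebra behind the exhaustion clause (c)).
For a family of order embeddings `f_j : Λ ↪o Λ'` (`j : J`, a finite index type) with pairwise disjoint ranges
COVERING `Λ'`, and unit vectors `w j` of the small Fock space of definite particle numbers, the embedded rank-one
projections `P_j = (f_j)_* |w j⟩⟨w j|` are even (`vecMulVec_self_mem_carEvenSubalgebra`), hence pairwise commuting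
Hermitian idempotents, and:

* `listProd_blockProj_eq_vecMulVec` — their ordered product is the rank-one projection `|Ω⟩⟨Ω|` onto ANY unit
  vector `Ω` fixed by all of them (the block product state of `exists_unit_blockProduct_vector_family`): the
  product is a Hermitian idempotent of trace `1` (the trace factorises over the disjoint CAR subalgebras,
  `trace_mul_of_mem_carSubalgebra`, and the cover is exact), and a trace-one projection fixing a unit vector is
  that vector's projection (`eq_vecMulVec_of_trace_one`);
* `listProd_add_blockProj_eq_sum` — for two such families `w 0 j ⊥ w 1 j` the ordered product of the embedded
  BAND projections `(f_j)_* (|w 0 j⟩⟨w 0 j| + |w 1 j⟩⟨w 1 j|)` expands (all factors commute) as the sum over the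
  assignments `κ : J → Fin 2` of the ordered products of the `P^{κ j}_j`;
* `eq_sum_of_fixed_by_bandProj` — consequently a vector fixed by every embedded band projection is the sum of
  its components along the product states `Ω_κ` of the assignments.

Applied (next file) to the plaquette family of the checkerboard torus and the plaquette ground states
`plaquetteStates U`, this is the exhaustion half of clause (c) of `PlaquetteDictionary`.

References: O. Bratteli, D. W. Robinson, *Operator Algebras and QSM II* (1997) §5.2.2 (product states; the trace
state is a product state); W.-F. Tsai, S. A. Kivelson, PRB 73 (2006) 214510, App. A. All statements are
[folklore]; no definition is introduced.
-/

set_option linter.dupNamespace false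

noncomputable section

namespace Summit.HubbardSuperconductivity.HubbardSuperconductivity.Theorems.LevyLogBootstrap

open Matrix Finset Literature.MathematicalPhysics.QuantumLattice Literature.Probability.LatticeModels
open Summit.HubbardSuperconductivity.HubbardSuperconductivity.Theorems.CooperPairDMottWalk
open scoped ComplexOrder

/-! ### A trace-one projection fixing a unit vector is the projection onto it -/

section RankOne

variable {n : Type*} [Fintype n]

/-- A Hermitian idempotent matrix of trace zero vanishes (`tr Q = tr Qᴴ Q = Σ |Q i j|²`). [folklore] -/
theorem eq_zero_of_isHermitian_idempotent_trace_zero {Q : Matrix n n ℂ} (hQ : Q.IsHermitian) (hQ2 : Q * Q = Q)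
    (htr : Q.trace = 0) : Q = 0 := by
  have h : (Qᴴ * Q).trace = 0 := by rw [hQ.eq, hQ2, htr]
  exact trace_conjTranspose_mul_self_eq_zero_iff.1 h

/-- **A trace-one orthogonal projection fixing a unit vector is the rank-one projection onto it**:
`Qᴴ = Q = Q²`, `tr Q = 1`, `Q u = u`, `‖u‖ = 1` ⟹ `Q = |u⟩⟨u|`. [folklore] -/
theorem eq_vecMulVec_of_trace_one {Q : Matrix n n ℂ} (hQ : Q.IsHermitian) (hQ2 : Q * Q = Q) (htr : Q.trace = 1)
    {u : n → ℂ} (hu1 : star u ⬝ᵥ u = 1) (hQu : Q *ᵥ u = u) : Q = vecMulVec u (star u) := by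
  set R := Q - vecMulVec u (star u) with hR
  have huQ : star u ᵥ* Q = star u := by
    have := congrArg star hQu
    rw [star_mulVec, hQ.eq] at this
    exact this
  have h1 : Q * vecMulVec u (star u) = vecMulVec u (star u) := by rw [mul_vecMulVec, hQu]
  have h2 : vecMulVec u (star u) * Q = vecMulVec u (star u) := by rw [vecMulVec_mul, huQ]
  have h3 : vecMulVec u (star u) * vecMulVec u (star u) = vecMulVec u (star u) := by
    rw [vecMulVec_mul_vecMulVec, hu1, one_smul]
  have hRh : R.IsHermitian := by
    rw [hR]
    exact hQ.sub (by rw [IsHermitian, conjTranspose_vecMulVec, star_star])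
  have hR2 : R * R = R := by
    rw [hR, sub_mul, mul_sub, mul_sub, hQ2, h1, h2, h3, sub_self, sub_zero]
  have hRtr : R.trace = 0 := by
    rw [hR, trace_sub, htr, trace_vecMulVec, dotProduct_comm, hu1, sub_self]
  have := eq_zero_of_isHermitian_idempotent_trace_zero hRh hR2 hRtr
  rw [hR] at this
  exact sub_eq_zero.1 this

end RankOne

/-! ### The embedded projections of one family: commuting Hermitian idempotents, their ordered product -/

section BlockProj

variable {Λ Λ' : Type*} [LinearOrder Λ] [Fintype Λ] [LinearOrder Λ'] [Fintype Λ'] {J : Type*} [DecidableEq J]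

/-- An embedded rank-one projection of a unit vector is a Hermitian idempotent. [folklore] -/
theorem jwEmbed_vecMulVec_isHermitian_idem (e : Λ ↪o Λ') {w : Fock (Orb Λ)} (hw1 : star w ⬝ᵥ w = 1) :
    (jwEmbed (orbEmb e) (vecMulVec w (star w)))ᴴ = jwEmbed (orbEmb e) (vecMulVec w (star w)) ∧
      jwEmbed (orbEmb e) (vecMulVec w (star w)) * jwEmbed (orbEmb e) (vecMulVec w (star w)) =
        jwEmbed (orbEmb e) (vecMulVec w (star w)) := by
  constructor
  · rw [← jwEmbed_conjTranspose, conjTranspose_vecMulVec, star_star]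
  · rw [← map_mul, vecMulVec_mul_vecMulVec, hw1, one_smul]

/-- Embedded projections of definite-particle-number vectors at disjoint blocks commute (they are even).
[cite: BratteliRobinsonII1997, §5.2.2] -/
theorem jwEmbed_vecMulVec_comm {e₁ e₂ : Λ ↪o Λ'}
    (h : Disjoint ((Finset.univ : Finset Λ).map e₁.toEmbedding) ((Finset.univ : Finset Λ).map e₂.toEmbedding))
    {w₁ w₂ : Fock (Orb Λ)} {a : ℕ} (hw₁ : IsNParticle a w₁) :
    jwEmbed (orbEmb e₁) (vecMulVec w₁ (star w₁)) * jwEmbed (orbEmb e₂) (vecMulVec w₂ (star w₂)) =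
      jwEmbed (orbEmb e₂) (vecMulVec w₂ (star w₂)) * jwEmbed (orbEmb e₁) (vecMulVec w₁ (star w₁)) :=
  (commute_jwEmbed_jwEmbed h (vecMulVec_self_mem_carEvenSubalgebra hw₁) _).eq

/-- **The ordered product of the embedded projections of a family** (pairwise disjoint ranges, unit vectors of
definite particle numbers) over a duplicate-free list is a Hermitian idempotent, and its trace satisfies
`tr(∏) · 2^{|Orb Λ| · |l|} = 2^{|Orb Λ'|}` (the trace state is a product state). [cite: BratteliRobinsonII1997, §5.2.2] -/
theorem listProd_blockProj_herm_idem_trace (T : Finset J) (f : J → Λ ↪o Λ')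
    (hdisj : ∀ j ∈ T, ∀ j' ∈ T, j ≠ j' →
      Disjoint ((Finset.univ : Finset Λ).map (f j).toEmbedding) ((Finset.univ : Finset Λ).map (f j').toEmbedding))
    (w : J → Fock (Orb Λ)) (hw1 : ∀ j ∈ T, star (w j) ⬝ᵥ w j = 1) (a : J → ℕ) (hwN : ∀ j ∈ T, IsNParticle (a j) (w j)) :
    ∀ l : List J, l.Nodup → (∀ j ∈ l, j ∈ T) →
      ((l.map fun j => jwEmbed (orbEmb (f j)) (vecMulVec (w j) (star (w j)))).prod)ᴴ =
          (l.map fun j => jwEmbed (orbEmb (f j)) (vecMulVec (w j) (star (w j)))).prod ∧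
        (l.map fun j => jwEmbed (orbEmb (f j)) (vecMulVec (w j) (star (w j)))).prod *
            (l.map fun j => jwEmbed (orbEmb (f j)) (vecMulVec (w j) (star (w j)))).prod =
          (l.map fun j => jwEmbed (orbEmb (f j)) (vecMulVec (w j) (star (w j)))).prod ∧
        ((l.map fun j => jwEmbed (orbEmb (f j)) (vecMulVec (w j) (star (w j)))).prod).trace *
            2 ^ (Fintype.card (Orb Λ) * l.length) = 2 ^ Fintype.card (Orb Λ')
  | [], _, _ => by
      refine ⟨by rw [List.map_nil, List.prod_nil, conjTranspose_one], by rw [List.map_nil, List.prod_nil, mul_one], ?_⟩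
      rw [List.map_nil, List.prod_nil, trace_one, List.length_nil, mul_zero, pow_zero, mul_one, Fintype.card_finset]
      norm_cast
  | (j :: l), hnd, hl => by
      rw [List.nodup_cons] at hnd
      have hjT : j ∈ T := hl j List.mem_cons_self
      have hlT : ∀ j' ∈ l, j' ∈ T := fun j' hj' => hl j' (List.mem_cons_of_mem _ hj')
      obtain ⟨ihH, ihI, ihT⟩ := listProd_blockProj_herm_idem_trace T f hdisj w hw1 a hwN l hnd.2 hlT
      set P := jwEmbed (orbEmb (f j)) (vecMulVec (w j) (star (w j))) with hP
      set Rst := (l.map fun j => jwEmbed (orbEmb (f j)) (vecMulVec (w j) (star (w j)))).prod with hRst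
      obtain ⟨hPh, hPP⟩ := jwEmbed_vecMulVec_isHermitian_idem (f j) (hw1 j hjT)
      -- `P` commutes with the rest
      have hcomm : P * Rst = Rst * P := by
        refine (Commute.list_prod_right _ _ fun x hx => ?_).eq
        obtain ⟨j', hj', rfl⟩ := List.mem_map.1 hx
        have hne : j ≠ j' := fun h => hnd.1 (h ▸ hj')
        exact jwEmbed_vecMulVec_comm (hdisj j hjT j' (hlT j' hj') hne) (hwN j hjT)
      rw [List.map_cons, List.prod_cons]
      refine ⟨?_, ?_, ?_⟩
      · rw [conjTranspose_mul, ihH, hPh, ← hcomm]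
      · calc P * Rst * (P * Rst) = P * (Rst * P) * Rst := by simp only [mul_assoc]
          _ = P * (P * Rst) * Rst := by rw [hcomm]
          _ = (P * P) * (Rst * Rst) := by simp only [mul_assoc]
          _ = P * Rst := by rw [hPP, ihI]
      · -- trace factorisation over the disjoint CAR subalgebras
        have hPmem : P ∈ carSubalgebra (orbs ((Finset.univ : Finset Λ).map (f j).toEmbedding)) :=
          jwEmbed_mem_carSubalgebra_orbs (f j) _
        have hRmem := list_prod_jwEmbed_mem_carSubalgebra f (fun j => vecMulVec (w j) (star (w j))) l
        have hS : Disjoint (orbs ((Finset.univ : Finset Λ).map (f j).toEmbedding))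
            (l.toFinset.biUnion fun j => orbs ((Finset.univ : Finset Λ).map (f j).toEmbedding)) := by
          rw [Finset.disjoint_biUnion_right]
          intro j' hj'
          have hj'l : j' ∈ l := List.mem_toFinset.1 hj'
          refine disjoint_orbs (hdisj j hjT j' (hlT j' hj'l) ?_)
          rintro rfl
          exact hnd.1 hj'l
        have key := trace_mul_of_mem_carSubalgebra hPmem hRmem hS
        have htrP : P.trace = 2 ^ (Fintype.card (Orb Λ') - Fintype.card (Orb Λ)) := by
          rw [hP, trace_jwEmbed, trace_vecMulVec, dotProduct_comm, hw1 j hjT, mul_one]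
        have hle : Fintype.card (Orb Λ) ≤ Fintype.card (Orb Λ') := Fintype.card_le_of_embedding (orbEmb (f j)).toEmbedding
        -- `tr(P R) 2^{n'} = tr P · tr R`, `tr P = 2^{n'-n}`, `tr R · 2^{n |l|} = 2^{n'}`
        have h2 : (2 : ℂ) ^ Fintype.card (Orb Λ') ≠ 0 := pow_ne_zero _ two_ne_zero
        apply mul_right_cancel₀ h2
        rw [List.length_cons]
        calc (P * Rst).trace * 2 ^ (Fintype.card (Orb Λ) * (l.length + 1)) * 2 ^ Fintype.card (Orb Λ')
            = (P * Rst).trace * 2 ^ Fintype.card (Orb Λ') * (2 ^ (Fintype.card (Orb Λ) * l.length) *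
                2 ^ Fintype.card (Orb Λ)) := by rw [← pow_add]; ring
          _ = P.trace * (Rst.trace * 2 ^ (Fintype.card (Orb Λ) * l.length)) * 2 ^ Fintype.card (Orb Λ) := by
                rw [key]; ring
          _ = 2 ^ (Fintype.card (Orb Λ') - Fintype.card (Orb Λ)) * 2 ^ Fintype.card (Orb Λ') *
                2 ^ Fintype.card (Orb Λ) := by rw [htrP, ihT]
          _ = 2 ^ Fintype.card (Orb Λ') * 2 ^ Fintype.card (Orb Λ') := by
                rw [mul_comm _ (2 ^ Fintype.card (Orb Λ')), mul_assoc, ← pow_add, Nat.sub_add_cancel hle]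

omit [DecidableEq J] in
/-- A vector fixed by every factor is fixed by the ordered product. [folklore] -/
theorem listProd_mulVec_eq_self_of_forall {N : Type*} [Fintype N] [DecidableEq N] (X : J → Matrix N N ℂ) {v : N → ℂ}
    (h : ∀ j, X j *ᵥ v = v) : ∀ l : List J, (l.map X).prod *ᵥ v = v
  | [] => by rw [List.map_nil, List.prod_nil, one_mulVec]
  | (j :: l) => by rw [List.map_cons, List.prod_cons, ← mulVec_mulVec, listProd_mulVec_eq_self_of_forall X h l, h j]

/-- **The ordered product of the embedded projections of a covering family is the projection onto the product
state**: if the ranges of `f_j`, `j : J` (all of a finite type), are pairwise disjoint and their orbitals exhaust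
`Orb Λ'` (`|J| · |Orb Λ| = |Orb Λ'|`), and `Ω` is ANY unit vector fixed by every `(f_j)_* |w j⟩⟨w j|`, then
`∏_j (f_j)_* |w j⟩⟨w j| = |Ω⟩⟨Ω|`. [cite: BratteliRobinsonII1997, §5.2.2] -/
theorem listProd_blockProj_eq_vecMulVec [Fintype J] (f : J → Λ ↪o Λ')
    (hdisj : ∀ j j', j ≠ j' →
      Disjoint ((Finset.univ : Finset Λ).map (f j).toEmbedding) ((Finset.univ : Finset Λ).map (f j').toEmbedding))
    (hcard : Fintype.card (Orb Λ) * Fintype.card J = Fintype.card (Orb Λ'))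
    (w : J → Fock (Orb Λ)) (hw1 : ∀ j, star (w j) ⬝ᵥ w j = 1) (a : J → ℕ) (hwN : ∀ j, IsNParticle (a j) (w j))
    {Ω : Fock (Orb Λ')} (hΩ1 : star Ω ⬝ᵥ Ω = 1)
    (hfix : ∀ j, jwEmbed (orbEmb (f j)) (vecMulVec (w j) (star (w j))) *ᵥ Ω = Ω) :
    ((Finset.univ : Finset J).toList.map fun j => jwEmbed (orbEmb (f j)) (vecMulVec (w j) (star (w j)))).prod =
      vecMulVec Ω (star Ω) := by
  obtain ⟨hH, hI, hT⟩ := listProd_blockProj_herm_idem_trace (Finset.univ : Finset J) f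
    (fun j _ j' _ hne => hdisj j j' hne) w (fun j _ => hw1 j) a (fun j _ => hwN j) (Finset.univ : Finset J).toList
    (Finset.nodup_toList _) (fun j _ => Finset.mem_univ j)
  refine eq_vecMulVec_of_trace_one hH hI ?_ hΩ1 (listProd_mulVec_eq_self_of_forall _ hfix _)
  rw [Finset.length_toList, Finset.card_univ, hcard] at hT
  exact mul_right_cancel₀ (pow_ne_zero _ two_ne_zero) (by rw [hT, one_mul])

end BlockProj

/-! ### Two orthogonal families: expansion of the product of the embedded band projections -/

section Expansion

variable {Λ Λ' : Type*} [LinearOrder Λ] [Fintype Λ] [LinearOrder Λ'] [Fintype Λ'] {J : Type*} [Fintype J] [DecidableEq J]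

/-- **Expansion of the ordered product of the embedded band projections.** For two families `w 0 j`, `w 1 j` of
unit vectors of definite particle numbers with `w 0 j ⊥ w 1 j`, over order embeddings with pairwise disjoint
ranges, all the embedded projections `P^i_j = (f_j)_* |w i j⟩⟨w i j|` commute, and
`∏_j (P^0_j + P^1_j) = Σ_{κ : J → Fin 2} ∏_j P^{κ j}_j` (ordered products over `univ.toList`).
[cite: BratteliRobinsonII1997, §5.2.2] -/
theorem listProd_add_blockProj_eq_sum (f : J → Λ ↪o Λ')
    (hdisj : ∀ j j', j ≠ j' →
      Disjoint ((Finset.univ : Finset Λ).map (f j).toEmbedding) ((Finset.univ : Finset Λ).map (f j').toEmbedding))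
    (w : Fin 2 → J → Fock (Orb Λ)) (a : Fin 2 → J → ℕ) (hwN : ∀ i j, IsNParticle (a i j) (w i j))
    (horth : ∀ j, star (w 0 j) ⬝ᵥ w 1 j = 0) :
    ((Finset.univ : Finset J).toList.map fun j =>
        jwEmbed (orbEmb (f j)) (vecMulVec (w 0 j) (star (w 0 j))) + jwEmbed (orbEmb (f j)) (vecMulVec (w 1 j) (star (w 1 j)))).prod =
      ∑ κ : J → Fin 2, ((Finset.univ : Finset J).toList.map fun j =>
        jwEmbed (orbEmb (f j)) (vecMulVec (w (κ j) j) (star (w (κ j) j)))).prod := by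
  classical
  -- all the projections commute: work in the commutative subalgebra they generate
  set P : Fin 2 → J → Matrix (Finset (Orb Λ')) (Finset (Orb Λ')) ℂ :=
    fun i j => jwEmbed (orbEmb (f j)) (vecMulVec (w i j) (star (w i j))) with hP
  set S : Set (Matrix (Finset (Orb Λ')) (Finset (Orb Λ')) ℂ) := {x | ∃ i j, x = P i j} with hS
  have horth' : ∀ j (i i' : Fin 2), i ≠ i' → star (w i j) ⬝ᵥ w i' j = 0 := by
    intro j i i' hne
    fin_cases i <;> fin_cases i'
    · exact absurd rfl hne
    · exact horth j
    · have := congrArg star (horth j)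
      rwa [star_dotProduct, star_star, star_zero] at this
    · exact absurd rfl hne
  have hcomm : ∀ x ∈ S, ∀ y ∈ S, x * y = y * x := by
    rintro _ ⟨i, j, rfl⟩ _ ⟨i', j', rfl⟩
    by_cases hjj : j = j'
    · subst hjj
      by_cases hii : i = i'
      · subst hii; rfl
      · show P i j * P i' j = P i' j * P i j
        simp only [hP]
        rw [← map_mul, ← map_mul, vecMulVec_mul_vecMulVec, vecMulVec_mul_vecMulVec, horth' j i i' hii,
          horth' j i' i (Ne.symm hii), zero_smul, zero_smul, vecMulVec_zero, vecMulVec_zero]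
    · exact jwEmbed_vecMulVec_comm (hdisj j j' hjj) (hwN i j)
  haveI := Algebra.isMulCommutative_adjoin ℂ hcomm
  set A : Subalgebra ℂ (Matrix (Finset (Orb Λ')) (Finset (Orb Λ')) ℂ) := Algebra.adjoin ℂ S with hA
  set p : Fin 2 → J → A := fun i j => ⟨P i j, Algebra.subset_adjoin ⟨i, j, rfl⟩⟩ with hp
  -- the expansion in the commutative subalgebra
  have key : ((Finset.univ : Finset J).toList.map fun j => p 0 j + p 1 j).prod =
      ∑ κ : J → Fin 2, ((Finset.univ : Finset J).toList.map fun j => p (κ j) j).prod := by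
    open scoped IsMulCommutative in
    rw [Finset.prod_map_toList]
    have h2 : ∀ j, p 0 j + p 1 j = ∑ i : Fin 2, p i j := fun j => by rw [Fin.sum_univ_two]
    simp_rw [h2]
    rw [Finset.prod_univ_sum (fun _ => (Finset.univ : Finset (Fin 2))) (fun j i => p i j), Fintype.piFinset_univ]
    refine Finset.sum_congr rfl fun κ _ => ?_
    rw [Finset.prod_map_toList]
  -- transport along the inclusion `A → Matrix`
  have hcoe : ∀ κ : J → Fin 2, ((Finset.univ : Finset J).toList.map fun j => P (κ j) j).prod =
      A.val (((Finset.univ : Finset J).toList.map fun j => p (κ j) j).prod) := by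
    intro κ
    rw [map_list_prod, List.map_map]
    rfl
  have hcoe2 : ((Finset.univ : Finset J).toList.map fun j => P 0 j + P 1 j).prod =
      A.val (((Finset.univ : Finset J).toList.map fun j => p 0 j + p 1 j).prod) := by
    rw [map_list_prod, List.map_map]
    rfl
  show ((Finset.univ : Finset J).toList.map fun j => P 0 j + P 1 j).prod =
    ∑ κ : J → Fin 2, ((Finset.univ : Finset J).toList.map fun j => P (κ j) j).prod
  rw [hcoe2, key, map_sum]
  exact Finset.sum_congr rfl fun κ _ => (hcoe κ).symm

/-- **A vector fixed by every embedded band projection is the sum of its components along the product states.**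
With the data of `listProd_add_blockProj_eq_sum`, an exact cover (`|J| · |Orb Λ| = |Orb Λ'|`), unit vectors and,
for every assignment `κ`, a unit vector `Ω κ` fixed by all `P^{κ j}_j`: if `(P^0_j + P^1_j) ψ = ψ` for all `j`
then `ψ = Σ_κ ⟨Ω κ, ψ⟩ Ω κ`. [cite: BratteliRobinsonII1997, §5.2.2] -/
theorem eq_sum_of_fixed_by_bandProj (f : J → Λ ↪o Λ')
    (hdisj : ∀ j j', j ≠ j' →
      Disjoint ((Finset.univ : Finset Λ).map (f j).toEmbedding) ((Finset.univ : Finset Λ).map (f j').toEmbedding))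
    (hcard : Fintype.card (Orb Λ) * Fintype.card J = Fintype.card (Orb Λ'))
    (w : Fin 2 → J → Fock (Orb Λ)) (hw1 : ∀ i j, star (w i j) ⬝ᵥ w i j = 1) (a : Fin 2 → J → ℕ)
    (hwN : ∀ i j, IsNParticle (a i j) (w i j)) (horth : ∀ j, star (w 0 j) ⬝ᵥ w 1 j = 0)
    (Ω : (J → Fin 2) → Fock (Orb Λ')) (hΩ1 : ∀ κ, star (Ω κ) ⬝ᵥ Ω κ = 1)
    (hΩfix : ∀ κ j, jwEmbed (orbEmb (f j)) (vecMulVec (w (κ j) j) (star (w (κ j) j))) *ᵥ Ω κ = Ω κ)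
    {ψ : Fock (Orb Λ')}
    (hψ : ∀ j, (jwEmbed (orbEmb (f j)) (vecMulVec (w 0 j) (star (w 0 j))) +
      jwEmbed (orbEmb (f j)) (vecMulVec (w 1 j) (star (w 1 j)))) *ᵥ ψ = ψ) :
    ψ = ∑ κ : J → Fin 2, (star (Ω κ) ⬝ᵥ ψ) • Ω κ := by
  have hexp := listProd_add_blockProj_eq_sum f hdisj w a hwN horth
  have hprodκ : ∀ κ : J → Fin 2, ((Finset.univ : Finset J).toList.map fun j =>
      jwEmbed (orbEmb (f j)) (vecMulVec (w (κ j) j) (star (w (κ j) j)))).prod = vecMulVec (Ω κ) (star (Ω κ)) :=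
    fun κ => listProd_blockProj_eq_vecMulVec f hdisj hcard (fun j => w (κ j) j) (fun j => hw1 (κ j) j)
      (fun j => a (κ j) j) (fun j => hwN (κ j) j) (hΩ1 κ) (hΩfix κ)
  have hfixed := listProd_mulVec_eq_self_of_forall (fun j =>
    jwEmbed (orbEmb (f j)) (vecMulVec (w 0 j) (star (w 0 j))) + jwEmbed (orbEmb (f j)) (vecMulVec (w 1 j) (star (w 1 j))))
    hψ (Finset.univ : Finset J).toList
  conv_lhs => rw [← hfixed, hexp]
  rw [sum_mulVec]
  refine Finset.sum_congr rfl fun κ _ => ?_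
  rw [hprodκ κ, vecMulVec_mulVec, op_smul_eq_smul]

end Expansion

/-! ### Registered form -/

/-- **Registered sub-goal `dressHalfFilled_bandProjectionExpansion`** (closed form, as registered on the crux item
stmt-HubbardSuperconductivity-8148): a vector fixed by every embedded band projection of two orthogonal families of
definite-particle-number unit vectors over an exactly covering block family is the sum of its components along the
product states of the assignments `κ : J → Fin 2`. [cite: BratteliRobinsonII1997, §5.2.2] -/
theorem dressHalfFilled_bandProjectionExpansion : ∀ {Λ Λ' : Type} [LinearOrder Λ] [Fintype Λ] [LinearOrder Λ'] [Fintype Λ'] {J : Type} [Fintype J] [DecidableEq J] (f : J → Λ ↪o Λ'), (∀ j j', j ≠ j' → Disjoint ((Finset.univ : Finset Λ).map (f j).toEmbedding) ((Finset.univ : Finset Λ).map (f j').toEmbedding)) → Fintype.card (Orb Λ) * Fintype.card J = Fintype.card (Orb Λ') → ∀ (w : Fin 2 → J → Fock (Orb Λ)), (∀ i j, star (w i j) ⬝ᵥ w i j = 1) → ∀ (a : Fin 2 → J → ℕ), (∀ i j, IsNParticle (a i j) (w i j)) → (∀ j, star (w 0 j) ⬝ᵥ w 1 j = 0) → ∀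 (Ω : (J → Fin 2) → Fock (Orb Λ')), (∀ κ, star (Ω κ) ⬝ᵥ Ω κ = 1) → (∀ κ j, jwEmbed (orbEmb (f j)) (vecMulVec (w (κ j) j) (star (w (κ j) j))) *ᵥ Ω κ = Ω κ) → ∀ {ψ : Fock (Orb Λ')}, (∀ j, (jwEmbed (orbEmb (f j)) (vecMulVec (w 0 j) (star (w 0 j))) + jwEmbed (orbEmb (f j)) (vecMulVec (w 1 j) (star (w 1 j)))) *ᵥ ψ = ψ) → ψ = ∑ κ : J → Fin 2, (star (Ω κ) ⬝ᵥ ψ) • Ω κ :=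
  fun f hdisj hcard w hw1 a hwN horth Ω hΩ1 hΩfix _ hψ =>
    eq_sum_of_fixed_by_bandProj f hdisj hcard w hw1 a hwN horth Ω hΩ1 hΩfix hψ

end Summit.HubbardSuperconductivity.HubbardSuperconductivity.Theorems.LevyLogBootstrap

end
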